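import Literature.Algebra.Module.DivisibleTorsionMultiplicativity
import HarnessLib

/-!
# Points block algebra for an `𝒪`-action: primary torsion under an equivariant homomorphism — preserved, injective off the kernel's support, and
# surjective for a surjection with bounded kernel ([AtiyahMacdonald1969] Prop. 1.10; [GortzWedhorn2023] Prop. 27.188 (2); [MumfordAV1970] §6 App. 3)

Topic `Literature/Algebra/Module`; namespace `Literature.Algebra.Module.DivisibleTorsionPrimaryImage` (sequel of ★ `DivisibleTorsionPointCount` ∕ ★ (M1)
`DivisibleTorsionMultiplicativity`, SAME multiplicative currency `φ : 𝒪 → M → M`, `M[𝔞] = {x ∣ φ(r) x = 1 ∀ r ∈ 𝔞}`).  THEOREMS ONLY (no definition, no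
named fact, no `instance`, no notation, no `sorry`); Mathlib + the two ★ files.  Cell `hodgecm-mathlib` (D-0151), P6 «MOD» (crux hLiu418 =
stmt-HodgeConjecture-24832, `--supports`, count-neutral): line L2, organ `stub_SPGEOM`, Road P′ of (ρ2″) «ROOF KERNEL SHAPE UPSTAIRS» (LA2-p03 (g2) head
`isIdealTorsion_mul_of_roof`), brick **(o2) «POINTS BLOCK ALGEBRA FOR AN 𝒪-ACTION»** (LA2-plan (g0) 2026-09-02T06:15:28Z text): for the points group
`M = A(Ω̄)` of an abelian variety with its `𝒪_F`-action (multiplicative, commutative, `ι(r)` surjective for `r ≠ 0`) and an `𝒪_F`-equivariant surjection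
`c : A(Ω̄) → A″(Ω̄)` with finite kernel: the CRT block split of `M[p]` along a pairwise-coprime factorisation, «`𝔮`-primary torsion is preserved by equivariant
homs», «`Ker c ⊆ M[𝔞]`, `𝔞 + 𝔟 = 𝒪` ⇒ `c` is injective on `M[𝔟^∞]`», and «`c` maps `M[𝔟^∞]` ONTO `M″[𝔟^∞]`» (with the explicit exponent shift `n ↦ n + m`,
`𝔞 = 𝔟^m·𝔠`, `𝔠 + 𝔟 = 𝒪`).  The CRT two-block facts themselves (`M[IJ] = M[I]·M[J]`, `M[I] ∩ M[J] = M[I+J]`) are ★ (M1) `exists_mul_eq_of_sup_eq_top` ∕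
`eq_one_of_torsion_of_sup_eq_top` ∕ ★ `torsion_sup` — CITED, not restated.  HC_CM is proved only modulo the printed citations until rung 0 closes; this file is
generic and changes no count.

THE MATHEMATICS (`φ`, `φ′` additive–multiplicative–unital families of endomorphisms of commutative groups `M`, `M′`; `f : M → M′` a homomorphism with
`f(φ(r)x) = φ′(r)(f x)`).  (1) `f(M[𝔞]) ⊆ M′[𝔞]` (equivariance).  (2) If `Ker f ⊆ M[𝔞]` and `𝔞 + 𝔟 = 𝒪` then `M[𝔟^n] ∩ Ker f ⊆ M[𝔟^n + 𝔞] = M[𝒪] = 1`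
(`𝔞 + 𝔟^n = 𝒪`, Mathlib `Ideal.sup_pow_eq_top`; ★ `torsion_sup`, `torsion_top`).  (3) If `f` is onto and `Ker f ⊆ M[𝔟^m 𝔠]` with `𝔠 + 𝔟 = 𝒪`: for `y ∈ M′[𝔟^n]`
pick `x` with `f x = y`; for `b ∈ 𝔟^n`, `f(φ(b)x) = φ′(b)y = 1`, so `φ(b)x ∈ M[𝔟^m 𝔠]`, whence `x ∈ M[𝔟^{n+m} 𝔠] = M[𝔟^{n+m}]·M[𝔠]` (★ (M1) CRT), `x = x₁x₂`;
then `f x₂ ∈ M′[𝔠] ∩ M′[𝔟^{n+m}] = 1`, so `y = f x₁` with `x₁ ∈ M[𝔟^{n+m}]` ([AtiyahMacdonald1969] Prop. 1.10).  (4) A FINITE `φ`-stable subgroup `K` is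
killed by the integer `#K` (Lagrange: `φ(n) x = x^n`), a nonzero scalar in characteristic `0`; over a Dedekind domain `(#K) = 𝔟^m 𝔠` with `𝔠 + 𝔟 = 𝒪`
for any maximal `𝔟` (Mathlib `Ideal.eq_prime_pow_mul_coprime`).  (5) Three pairwise-coprime ideals: `M[IJK] = M[I]·M[J]·M[K]` (★ CRT twice,
`(I·J) + K = 𝒪` from Mathlib `Ideal.sup_mul_eq_of_coprime_left`).

* §1 `torsion_map` (1); §2 **`eq_one_of_torsion_pow_of_ker_le`** (2) and `injOn_torsion_pow_of_ker_le`;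
* §3 `torsion_mul_of_forall_act_torsion` (`φ(b)x ∈ M[𝔞] ∀ b ∈ 𝔟 ⇒ x ∈ M[𝔟·𝔞]`), **`exists_torsion_pow_map_eq_of_surjective`** (3);
* §4 `natCast_act_eq_pow` (`φ(n) x = x^n`), **`forall_natCard_act_eq_one_of_finite`** (4) (`(#K)` kills a finite subgroup `K`), `ker_torsion_span_natCard`,
  **`exists_torsion_pow_map_eq_of_surjective_of_finite_ker`** ((3)+(4) over a Dedekind domain of characteristic `0`);
* §5 `exists_mul_mul_eq_of_coprime₃` ∕ `eq_one_of_mul_mul_eq_one_of_coprime₃` (5).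

## References
* [AtiyahMacdonald1969] M. F. Atiyah, I. G. Macdonald, *Introduction to Commutative Algebra* (1969) — Prop. 1.10 (p. 7).
* [GortzWedhorn2023] U. Görtz, T. Wedhorn, *Algebraic Geometry II* (2023) — Prop. 27.188 (2).
* [MumfordAV1970] D. Mumford, *Abelian Varieties* (1970) — §6 Application 3 (p. 64).
-/

set_option autoImplicit false

namespace Literature.Algebra.Module.DivisibleTorsionPrimaryImage

open Literature.Algebra.Module.DivisibleTorsionPointCount Literature.Algebra.Module.DivisibleTorsionMultiplicativity

variable {M M' : Type*} [CommGroup M] [CommGroup M'] {O : Type*} [CommRing O]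
  (φ : O → M → M) (φ' : O → M' → M') (f : M →* M') (hf : ∀ r x, f (φ r x) = φ' r (f x))

/-! ## §1 Equivariant homomorphisms preserve `𝔞`-torsion -/

include hf in
/-- **(1) `f(M[𝔞]) ⊆ M′[𝔞]`** for an equivariant homomorphism `f`. [cite: GortzWedhorn2023, Prop. 27.188 (2)] -/
theorem torsion_map {𝔞 : Ideal O} {x : M} (hx : ∀ r ∈ 𝔞, φ r x = 1) : ∀ r ∈ 𝔞, φ' r (f x) = 1 := fun r hr => by
  rw [← hf, hx r hr, map_one]

/-! ## §2 Injectivity on `𝔟`-primary torsion when the kernel is `𝔞`-torsion, `𝔞 + 𝔟 = 𝒪` -/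

/-- **(2) `M[𝔟^n] ∩ Ker f = 1`** when `Ker f ⊆ M[𝔞]` and `𝔞 + 𝔟 = 𝒪` (`𝔞 + 𝔟^n = 𝒪`; ★ `torsion_sup`, ★ `torsion_top`).
[cite: AtiyahMacdonald1969, Prop. 1.10 (p. 7)] -/
theorem eq_one_of_torsion_pow_of_ker_le (hmul : ∀ r x y, φ r (x * y) = φ r x * φ r y) (hadd : ∀ r s x, φ (r + s) x = φ r x * φ s x)
    (hone : ∀ x, φ 1 x = x) {𝔞 𝔟 : Ideal O} (h𝔞𝔟 : 𝔞 ⊔ 𝔟 = ⊤) (hker : ∀ x, f x = 1 → ∀ r ∈ 𝔞, φ r x = 1)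
    (n : ℕ) {x : M} (hx : ∀ r ∈ 𝔟 ^ n, φ r x = 1) (hfx : f x = 1) : x = 1 := by
  have hsup : 𝔞 ⊔ 𝔟 ^ n = ⊤ := Ideal.sup_pow_eq_top h𝔞𝔟
  exact eq_one_of_torsion_of_sup_eq_top φ hmul hadd hone hsup (hker x hfx) hx

/-- **(2′) `f` is INJECTIVE on `M[𝔟^n]`** when `Ker f ⊆ M[𝔞]` and `𝔞 + 𝔟 = 𝒪`. [cite: AtiyahMacdonald1969, Prop. 1.10 (p. 7)] -/
theorem injOn_torsion_pow_of_ker_le (hmul : ∀ r x y, φ r (x * y) = φ r x * φ r y) (hadd : ∀ r s x, φ (r + s) x = φ r x * φ s x)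
    (hone : ∀ x, φ 1 x = x) {𝔞 𝔟 : Ideal O} (h𝔞𝔟 : 𝔞 ⊔ 𝔟 = ⊤) (hker : ∀ x, f x = 1 → ∀ r ∈ 𝔞, φ r x = 1) (n : ℕ) :
    Set.InjOn f {x : M | ∀ r ∈ 𝔟 ^ n, φ r x = 1} := by
  intro x hx y hy hxy
  have hone' : ∀ r, φ r 1 = 1 := map_one_of_mul φ hmul
  have h : x * y⁻¹ = 1 := by
    refine eq_one_of_torsion_pow_of_ker_le φ f hmul hadd hone h𝔞𝔟 hker n (x := x * y⁻¹) (fun r hr => ?_) ?_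
    · have hy' : φ r y⁻¹ = (φ r y)⁻¹ := by
        rw [eq_inv_iff_mul_eq_one, ← hmul, inv_mul_cancel, hone' r]
      rw [hmul, hx r hr, hy', hy r hr, inv_one, one_mul]
    · rw [map_mul, map_inv, hxy, mul_inv_cancel]
  exact mul_inv_eq_one.mp h

/-! ## §3 Surjectivity onto `𝔟`-primary torsion for a surjection with `𝔟^m 𝔠`-torsion kernel -/

/-- If `φ(b) x ∈ M[𝔞]` for every `b ∈ 𝔟` then `x ∈ M[𝔟·𝔞]` (`φ(b a) = φ(a) ∘ φ(b)`; products `b a` generate `𝔟 𝔞` and `M[·]` is a subgroup).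
[cite: GortzWedhorn2023, Prop. 27.188 (2)] -/
theorem torsion_mul_of_forall_act_torsion (hadd : ∀ r s x, φ (r + s) x = φ r x * φ s x)
    (hcomp : ∀ r s x, φ (r * s) x = φ r (φ s x)) {𝔞 𝔟 : Ideal O} {x : M} (hx : ∀ b ∈ 𝔟, ∀ r ∈ 𝔞, φ r (φ b x) = 1) :
    ∀ r ∈ 𝔟 * 𝔞, φ r x = 1 := by
  intro r hr
  refine Submodule.mul_induction_on hr (fun b hb a ha => ?_) (fun r s ihr ihs => ?_)
  · rw [mul_comm, hcomp]
    exact hx b hb a ha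
  · rw [hadd, ihr, ihs, one_mul]

/-- **(3) AN EQUIVARIANT SURJECTION WITH `𝔟^m 𝔠`-TORSION KERNEL (`𝔠 + 𝔟 = 𝒪`) MAPS `M[𝔟^{n+m}]` ONTO `M′[𝔟^n]`** — so `f(M[𝔟^∞]) = M′[𝔟^∞]`: lift `y ∈ M′[𝔟^n]` to
any `x`, observe `x ∈ M[𝔟^{n+m} 𝔠]`, split `x = x₁ x₂` by ★ (M1) CRT (`𝔟^{n+m} + 𝔠 = 𝒪`), and discard `f x₂ ∈ M′[𝔠] ∩ M′[𝔟^{n+m}] = 1`.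
[cite: AtiyahMacdonald1969, Prop. 1.10 (p. 7)] [cite: MumfordAV1970, §6 Application 3 (p. 64)] -/
theorem exists_torsion_pow_map_eq_of_surjective
    (hadd : ∀ r s x, φ (r + s) x = φ r x * φ s x) (hcomp : ∀ r s x, φ (r * s) x = φ r (φ s x)) (hone : ∀ x, φ 1 x = x)
    (hmul' : ∀ r x y, φ' r (x * y) = φ' r x * φ' r y) (hadd' : ∀ r s x, φ' (r + s) x = φ' r x * φ' s x) (hone' : ∀ x, φ' 1 x = x)
    (hf : ∀ r x, f (φ r x) = φ' r (f x)) (hsurj : Function.Surjective f)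
    {𝔟 𝔠 : Ideal O} (h𝔠𝔟 : 𝔠 ⊔ 𝔟 = ⊤) (m : ℕ) (hker : ∀ x, f x = 1 → ∀ r ∈ 𝔟 ^ m * 𝔠, φ r x = 1)
    (n : ℕ) (y : M') (hy : ∀ r ∈ 𝔟 ^ n, φ' r y = 1) :
    ∃ x : M, (∀ r ∈ 𝔟 ^ (n + m), φ r x = 1) ∧ f x = y := by
  obtain ⟨x, rfl⟩ := hsurj y
  -- `x ∈ M[𝔟^n · (𝔟^m 𝔠)] = M[𝔟^{n+m} · 𝔠]`
  have hx : ∀ r ∈ 𝔟 ^ (n + m) * 𝔠, φ r x = 1 := by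
    have h := torsion_mul_of_forall_act_torsion φ hadd hcomp (𝔞 := 𝔟 ^ m * 𝔠) (𝔟 := 𝔟 ^ n) (x := x)
      (fun b hb => hker (φ b x) (by rw [hf, hy b hb]))
    rwa [← mul_assoc, ← pow_add] at h
  -- CRT split `x = x₁ x₂`, `x₁ ∈ M[𝔟^{n+m}]`, `x₂ ∈ M[𝔠]`
  have hsup : 𝔟 ^ (n + m) ⊔ 𝔠 = ⊤ := by rw [sup_comm]; exact Ideal.sup_pow_eq_top h𝔠𝔟
  obtain ⟨x₁, x₂, hx₁, hx₂, hx12⟩ := exists_mul_eq_of_sup_eq_top φ hadd hcomp hone hsup hx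
  refine ⟨x₁, hx₁, ?_⟩
  -- `f x₂ ∈ M′[𝔠] ∩ M′[𝔟^{n+m}] = 1`
  have hfx₁ : ∀ r ∈ 𝔟 ^ (n + m), φ' r (f x₁) = 1 := torsion_map φ φ' f hf hx₁
  have hfx₂𝔠 : ∀ r ∈ 𝔠, φ' r (f x₂) = 1 := torsion_map φ φ' f hf hx₂
  have hy' : ∀ r ∈ 𝔟 ^ (n + m), φ' r (f x) = 1 := fun r hr => hy r (Ideal.pow_le_pow_right (Nat.le_add_right n m) hr)
  have hone'' : ∀ r, φ' r 1 = 1 := map_one_of_mul φ' hmul'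
  have hfx₂𝔟 : ∀ r ∈ 𝔟 ^ (n + m), φ' r (f x₂) = 1 := fun r hr => by
    have h := hy' r hr
    rw [← hx12, map_mul, hmul', hfx₁ r hr, one_mul] at h
    exact h
  have h2 : f x₂ = 1 := eq_one_of_torsion_of_sup_eq_top φ' hmul' hadd' hone' hsup hfx₂𝔟 hfx₂𝔠
  rw [← hx12, map_mul, h2, mul_one]

/-! ## §4 A finite stable subgroup is killed by its order -/

/-- `φ(n) x = x^n` for an additive unital family (`φ(0) = 1` from additivity). [cite: GortzWedhorn2023, Prop. 27.188 (2)] -/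
theorem natCast_act_eq_pow (hadd : ∀ r s x, φ (r + s) x = φ r x * φ s x)
    (hone : ∀ x, φ 1 x = x) (n : ℕ) (x : M) : φ (n : O) x = x ^ n := by
  induction n with
  | zero =>
    have h0 : φ 0 x = φ 0 x * φ 0 x := by rw [← hadd, add_zero]
    rw [Nat.cast_zero, pow_zero]
    exact left_eq_mul.mp h0
  | succ n ih => rw [Nat.cast_succ, hadd, ih, hone, pow_succ]

/-- **(4) A FINITE `φ`-STABLE SUBGROUP `K` IS KILLED BY THE SCALAR `#K`** (Lagrange), hence by the principal ideal `(#K)`; in characteristic `0` this is a nonzero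
ideal, which over a Dedekind domain factors as `𝔟^m 𝔠` with `𝔠 + 𝔟 = 𝒪` for any maximal `𝔟` (Mathlib `Ideal.eq_prime_pow_mul_coprime`) — the `hker` input of §3
for a surjection with finite kernel. [cite: AtiyahMacdonald1969, Prop. 1.10 (p. 7)] -/
theorem forall_natCard_act_eq_one_of_finite (hmul : ∀ r x y, φ r (x * y) = φ r x * φ r y) (hadd : ∀ r s x, φ (r + s) x = φ r x * φ s x)
    (hcomp : ∀ r s x, φ (r * s) x = φ r (φ s x)) (hone : ∀ x, φ 1 x = x) (K : Subgroup M) [Finite K] (x : M) (hx : x ∈ K) :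
    ∀ r ∈ Ideal.span {((Nat.card K : ℕ) : O)}, φ r x = 1 := by
  have hN : φ ((Nat.card K : ℕ) : O) x = 1 := by
    rw [natCast_act_eq_pow φ hadd hone]
    have h := Subgroup.pow_index_mem (⊥ : Subgroup K) ⟨x, hx⟩
    rw [Subgroup.index_bot, Subgroup.mem_bot, Subtype.ext_iff, SubmonoidClass.coe_pow] at h
    exact h
  intro r hr
  obtain ⟨s, rfl⟩ := Ideal.mem_span_singleton'.mp hr
  rw [hcomp, hN, map_one_of_mul φ hmul]

/-- The kernel of a homomorphism with FINITE kernel is killed by the principal ideal `(#Ker f)` (§4 at `K := Ker f`) — the `hker` shape of §2∕§3.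
[cite: AtiyahMacdonald1969, Prop. 1.10 (p. 7)] -/
theorem ker_torsion_span_natCard (hmul : ∀ r x y, φ r (x * y) = φ r x * φ r y) (hadd : ∀ r s x, φ (r + s) x = φ r x * φ s x)
    (hcomp : ∀ r s x, φ (r * s) x = φ r (φ s x)) (hone : ∀ x, φ 1 x = x) [Finite f.ker] (x : M) (hfx : f x = 1) :
    ∀ r ∈ Ideal.span {((Nat.card f.ker : ℕ) : O)}, φ r x = 1 :=
  forall_natCard_act_eq_one_of_finite φ hmul hadd hcomp hone f.ker x (f.mem_ker.mpr hfx)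

/-- **(3)+(4) OVER A DEDEKIND DOMAIN OF CHARACTERISTIC `0`: an equivariant surjection with FINITE kernel maps `M[𝔟^∞]` ONTO `M′[𝔟^∞]`** for every maximal
`𝔟 ≠ 0` — precisely, with `m :=` the multiplicity of `𝔟` in `(#Ker f)`, every `y ∈ M′[𝔟^n]` lifts to some `x ∈ M[𝔟^{n+m}]`.  (`(#Ker f) ≠ 0` by characteristic
`0`; `(#Ker f) = 𝔟^m 𝔠`, `𝔟 + 𝔠 = 𝒪`, Mathlib `Ideal.eq_prime_pow_mul_coprime`.) [cite: AtiyahMacdonald1969, Prop. 1.10 (p. 7)] [cite: MumfordAV1970, §6 Application 3 (p. 64)] -/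
theorem exists_torsion_pow_map_eq_of_surjective_of_finite_ker [IsDedekindDomain O] [CharZero O]
    (hmul : ∀ r x y, φ r (x * y) = φ r x * φ r y) (hadd : ∀ r s x, φ (r + s) x = φ r x * φ s x)
    (hcomp : ∀ r s x, φ (r * s) x = φ r (φ s x)) (hone : ∀ x, φ 1 x = x)
    (hmul' : ∀ r x y, φ' r (x * y) = φ' r x * φ' r y) (hadd' : ∀ r s x, φ' (r + s) x = φ' r x * φ' s x) (hone' : ∀ x, φ' 1 x = x)
    (hf : ∀ r x, f (φ r x) = φ' r (f x)) (hsurj : Function.Surjective f) [Finite f.ker]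
    (𝔟 : Ideal O) [𝔟.IsMaximal] :
    ∃ m : ℕ, ∀ (n : ℕ) (y : M'), (∀ r ∈ 𝔟 ^ n, φ' r y = 1) → ∃ x : M, (∀ r ∈ 𝔟 ^ (n + m), φ r x = 1) ∧ f x = y := by
  have hN0 : Ideal.span {((Nat.card f.ker : ℕ) : O)} ≠ ⊥ := by
    rw [Ne, Ideal.span_singleton_eq_bot, Nat.cast_eq_zero]
    haveI : Nonempty f.ker := ⟨1⟩
    exact Nat.card_pos.ne'
  obtain ⟨𝔠, h𝔟𝔠, hN⟩ := Ideal.eq_prime_pow_mul_coprime hN0 𝔟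
  refine ⟨Multiset.count 𝔟 (UniqueFactorizationMonoid.normalizedFactors (Ideal.span {((Nat.card f.ker : ℕ) : O)})), fun n y hy => ?_⟩
  refine exists_torsion_pow_map_eq_of_surjective φ φ' f hadd hcomp hone hmul' hadd' hone' hf hsurj (by rw [sup_comm]; exact h𝔟𝔠) _
    (fun x hfx => ?_) n y hy
  rw [← hN]
  exact ker_torsion_span_natCard φ f hmul hadd hcomp hone x hfx

/-! ## §5 Three pairwise-coprime blocks -/

/-- **THREE-BLOCK CRT, existence**: for pairwise coprime `I`, `J`, `K`, every `x ∈ M[IJK]` is `x₁ x₂ x₃` with `x₁ ∈ M[I]`, `x₂ ∈ M[J]`, `x₃ ∈ M[K]` (★ (M1) CRT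
twice; `IJ + K = 𝒪` by Mathlib `Ideal.mul_sup_eq_of_coprime_left`∕`sup_mul_eq_of_coprime`).  (The split of `M[p]` along `(p) = 𝔭_w · 𝔭̄ · 𝔟` under `hunr`.)
[cite: AtiyahMacdonald1969, Prop. 1.10 (p. 7)] -/
theorem exists_mul_mul_eq_of_coprime₃ (hadd : ∀ r s x, φ (r + s) x = φ r x * φ s x) (hcomp : ∀ r s x, φ (r * s) x = φ r (φ s x))
    (hone : ∀ x, φ 1 x = x) {I J K : Ideal O} (hIJ : I ⊔ J = ⊤) (hIK : I ⊔ K = ⊤) (hJK : J ⊔ K = ⊤) {x : M}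
    (hx : ∀ r ∈ I * J * K, φ r x = 1) :
    ∃ x₁ x₂ x₃ : M, (∀ r ∈ I, φ r x₁ = 1) ∧ (∀ r ∈ J, φ r x₂ = 1) ∧ (∀ r ∈ K, φ r x₃ = 1) ∧ x₁ * x₂ * x₃ = x := by
  have hIJK : I * J ⊔ K = ⊤ := (Ideal.mul_sup_eq_of_coprime_left hIK).trans hJK
  obtain ⟨x₁₂, x₃, h₁₂, h₃, h⟩ := exists_mul_eq_of_sup_eq_top φ hadd hcomp hone hIJK hx
  obtain ⟨x₁, x₂, h₁, h₂, h'⟩ := exists_mul_eq_of_sup_eq_top φ hadd hcomp hone hIJ h₁₂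
  exact ⟨x₁, x₂, x₃, h₁, h₂, h₃, by rw [h', h]⟩

/-- **THREE-BLOCK CRT, uniqueness∕independence**: for pairwise coprime `I`, `J`, `K`, if `x₁ x₂ x₃ = 1` with `xᵢ` in the three blocks then `x₁ = x₂ = x₃ = 1`.
[cite: AtiyahMacdonald1969, Prop. 1.10 (p. 7)] -/
theorem eq_one_of_mul_mul_eq_one_of_coprime₃ (hmul : ∀ r x y, φ r (x * y) = φ r x * φ r y) (hadd : ∀ r s x, φ (r + s) x = φ r x * φ s x)
    (hone : ∀ x, φ 1 x = x) {I J K : Ideal O} (hIJ : I ⊔ J = ⊤) (hIK : I ⊔ K = ⊤) (hJK : J ⊔ K = ⊤) {x₁ x₂ x₃ : M}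
    (h₁ : ∀ r ∈ I, φ r x₁ = 1) (h₂ : ∀ r ∈ J, φ r x₂ = 1) (h₃ : ∀ r ∈ K, φ r x₃ = 1) (h : x₁ * x₂ * x₃ = 1) :
    x₁ = 1 ∧ x₂ = 1 ∧ x₃ = 1 := by
  have hone' : ∀ r, φ r 1 = 1 := map_one_of_mul φ hmul
  have hinv : ∀ {L : Ideal O} {z : M}, (∀ r ∈ L, φ r z = 1) → ∀ r ∈ L, φ r z⁻¹ = 1 := fun {L z} hz r hr => by
    have h0 := hmul r z z⁻¹
    rw [mul_inv_cancel, hone' r, hz r hr, one_mul] at h0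
    exact h0.symm
  have hIJK : I * J ⊔ K = ⊤ := (Ideal.mul_sup_eq_of_coprime_left hIK).trans hJK
  -- `x₁ x₂ = x₃⁻¹ ∈ M[IJ] ∩ M[K] = 1`
  have h12 : ∀ r ∈ I * J, φ r (x₁ * x₂) = 1 := fun r hr => by
    rw [hmul, h₁ r (Ideal.mul_le_right hr), h₂ r (Ideal.mul_le_left hr), one_mul]
  have h12K : ∀ r ∈ K, φ r (x₁ * x₂) = 1 := by
    have he : x₁ * x₂ = x₃⁻¹ := eq_inv_of_mul_eq_one_left h
    rw [he]
    exact hinv h₃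
  have h12one : x₁ * x₂ = 1 := eq_one_of_torsion_of_sup_eq_top φ hmul hadd hone hIJK h12 h12K
  have h3one : x₃ = 1 := by rwa [h12one, one_mul] at h
  -- `x₁ = x₂⁻¹ ∈ M[I] ∩ M[J] = 1`
  have h1J : ∀ r ∈ J, φ r x₁ = 1 := by
    have he : x₁ = x₂⁻¹ := eq_inv_of_mul_eq_one_left h12one
    rw [he]
    exact hinv h₂
  have h1one : x₁ = 1 := eq_one_of_torsion_of_sup_eq_top φ hmul hadd hone hIJ h₁ h1J
  have h2one : x₂ = 1 := by rwa [h1one, one_mul] at h12one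
  exact ⟨h1one, h2one, h3one⟩

end Literature.Algebra.Module.DivisibleTorsionPrimaryImage
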